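import Summits.ABC.StewartYu.ArchG3RecLinesFK
import Summits.ABC.StewartYu.ArchG3RecU0
import HarnessLib

/-!
# The archimedean record `ArchG3Rec` — letter lines in closed form, file G: THE GAIN, THE ORDER SPLIT, SMALLNESS

Support file (theorems only; no named facts). Cell `abc-stewartyu`, route `YuMatveevShapeRat`, crux r2 `ArchCoreRat`
(stmt-ABC-20502), line `arch-g3-frame`, stub `stub_recLinesArch`; infrastructure of the (F) budget lines of the k-step
(K0, K) and odd-step (O) families (R50: p1), on p5's `ArchG3RecLinesClosedK` letters:
* `R_succ_le`: `R (lev+1) ≤ T lev + (Ŝ − lev)` (the halving schedule `T s = max(1, ⌊8L/2^s⌋)`);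
  `Tf_pos_le`: `Tf lev μ ≤ (3/4)L + (n+1)(Ŝ+1) + (2n+1)·T lev` for `μ ≥ 1`, `n ≥ 2` — the orders of a step split into an
  `L`-part and a `T lev`-part;
* `γb_wl_Xs_le`: `γb lev·Xs lev ≤ (nL/2 + wl 0)(X/2 + 1)`, `wl lev·Xs lev ≤ wl 0·(X/2 + 1)`, `γb lev ≤ nL/2 + wl 0`, `wl lev ≤ wl 0`;
* `gain_K_ge`, `gain_O_ge`: `4·2^ν·Z + 4·2^ν·Z·(T−1)/(T+1) ≤ (2·Nf lev ν + 1)·T lev·G` and `4Z + 4Z(T−1)/(T+1) ≤ 2·Nh lev·T lev·G`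
  (from `Xs·(T+1) ≥ 4XL`);
* `T_absorb`: `(2n+1)·T lev·Λ ≤ 4·Z·(T−1)/(T+1) + (2n+1)·Λ` whenever `Λ ≤ (16/9)·X` — the `T lev`-part of the orders is
  paid by the surplus of the gain over `4·2^ν·Z`;
* `small_of_U0`: `LbRK (2^(n−1)) lev jl·δR c·ρ ≤ 1` for `0 ≤ ρ ≤ 2^{Ŝ+n+6}·e^G·X` and `2^63 ≤ c` (p4's `U0_ge 3`: `2^{3n}·Z ≤ U0 c`).

## References
* [Nesterenko2003] Yu. V. Nesterenko, LNM 1819 (2003) — §4 (4.3)–(4.5), (4.25); §4.2 (4.24)–(4.35).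
-/

noncomputable section

open Finset Real
open scoped Nat

namespace Summit.ABC.StewartYu

namespace ArchG3Rec

open PadicG3Par (Cb Cb_pos)
open ArchG3Par (G K yloadK G_eq G_pos K_pos yloadK_pos)

variable {n : ℕ} (P : ArchG3Rec n)

/-! ### The remaining drops -/

/-- a halving sequence sums to at most twice its first term: `q (s+1) ≤ q s / 2 ⇒ Σ_{s ∈ [a, a+m]} q s ≤ 2·q a`. [folklore] -/
theorem sum_halving (q : ℕ → ℕ) (hq : ∀ s, q (s + 1) ≤ q s / 2) (a m : ℕ) : ∑ s ∈ Icc a (a + m), q s ≤ 2 * q a := by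
  induction m generalizing a with
  | zero => simp; omega
  | succ m ih =>
    rw [← insert_Icc_add_one_left_eq_Icc (by omega : a ≤ a + (m + 1)), sum_insert (by simp),
      show a + (m + 1) = (a + 1) + m by ring]
    have h1 := ih (a + 1)
    have h2 := hq a
    have h3 : 2 * (q a / 2) ≤ q a := Nat.mul_div_le (q a) 2
    omega

/-- **`R (lev+1) ≤ T lev + (Ŝ − lev)`** (`T s ≤ ⌊8L/2^s⌋ + 1`, the halving sum `Σ_{s>lev} ⌊8L/2^s⌋ ≤ 2⌊8L/2^{lev+1}⌋ ≤ T lev`). [folklore] -/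
theorem R_succ_le (lev : ℕ) : P.R (lev + 1) ≤ P.T lev + (P.Sd - lev) := by
  rcases Nat.lt_or_ge P.Sd (lev + 1) with h | h
  · rw [P.R_eq_zero (lev + 1) h]; omega
  · unfold R
    obtain ⟨m, hm⟩ : ∃ m, P.Sd = lev + 1 + m := ⟨P.Sd - (lev + 1), by omega⟩
    rw [hm]
    have hq : ∀ s, 8 * P.L / 2 ^ (s + 1) ≤ 8 * P.L / 2 ^ s / 2 := fun s => by
      rw [pow_succ, Nat.div_div_eq_div_mul]
    have hsum : ∑ s ∈ Icc (lev + 1) (lev + 1 + m), 8 * P.L / 2 ^ s ≤ 2 * (8 * P.L / 2 ^ (lev + 1)) :=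
      sum_halving (fun s => 8 * P.L / 2 ^ s) hq (lev + 1) m
    have hT : ∀ s, P.T s ≤ 8 * P.L / 2 ^ s + 1 := fun s => by
      unfold T; exact max_le (Nat.le_add_left 1 _) (Nat.le_succ _)
    have h1 : ∑ s ∈ Icc (lev + 1) (lev + 1 + m), P.T s ≤ ∑ s ∈ Icc (lev + 1) (lev + 1 + m), (8 * P.L / 2 ^ s + 1) :=
      sum_le_sum fun s _ => hT s
    rw [sum_add_distrib, sum_const, Nat.card_Icc, smul_eq_mul, mul_one] at h1
    have h2 : 2 * (8 * P.L / 2 ^ (lev + 1)) ≤ P.T lev := by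
      have := P.div_le_T lev
      have e : 8 * P.L / 2 ^ (lev + 1) = 8 * P.L / 2 ^ lev / 2 := by rw [pow_succ, Nat.div_div_eq_div_mul]
      omega
    omega

set_option maxHeartbeats 400000 in
/-- **the orders of a step, split**: `Tf lev μ ≤ (3/4)·L + (n+1)·(Ŝ+1) + (2n+1)·T lev` for `μ ≥ 1`, `n ≥ 2`
(`M/(n+2)³ ≤ 16(n+1)L/(n+2)³ ≤ 3L/4`, `R(lev+1) ≤ T lev + Ŝ + 1`… and `(n+1−μ)·T lev ≤ n·T lev`). [cite: Nesterenko2003, (4.5)] -/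
theorem Tf_pos_le (hn2 : 2 ≤ n) (lev μ : ℕ) (hμ : 1 ≤ μ) :
    (P.Tf lev μ : ℝ) ≤ 3 / 4 * P.L + ((n : ℝ) + 1) * (P.Sd + 1) + (2 * n + 1) * P.T lev := by
  have hR := P.R_succ_le lev
  have hM : P.M / (n + 2) ^ 3 * 4 ≤ 3 * P.L := by
    have h1 : P.M / (n + 2) ^ 3 * (n + 2) ^ 3 ≤ P.M := Nat.div_mul_le_self _ _
    have h2 : 64 * (n + 1) ≤ 3 * (n + 2) ^ 3 := by
      rcases Nat.lt_or_ge n 3 with h3 | h3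
      · interval_cases n; norm_num
      · have h25 : 25 ≤ (n + 2) ^ 2 := by nlinarith
        have e : (n + 2) ^ 3 = (n + 2) ^ 2 * (n + 2) := by ring
        rw [e]; nlinarith
    unfold M at h1 ⊢
    -- `q·(n+2)^3 ≤ 16(n+1)L` and `64(n+1) ≤ 3(n+2)^3` ⇒ `4q ≤ 3L`
    have h3 : P.M / (n + 2) ^ 3 * 4 * (3 * (n + 2) ^ 3) ≤ 3 * P.L * (3 * (n + 2) ^ 3) := by
      calc P.M / (n + 2) ^ 3 * 4 * (3 * (n + 2) ^ 3) = 12 * (P.M / (n + 2) ^ 3 * (n + 2) ^ 3) := by ring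
        _ ≤ 12 * (16 * (n + 1) * P.L) := by unfold M; omega
        _ = 3 * P.L * (64 * (n + 1)) := by ring
        _ ≤ 3 * P.L * (3 * (n + 2) ^ 3) := Nat.mul_le_mul_left _ h2
    exact Nat.le_of_mul_le_mul_right h3 (by positivity)
  have hnat : P.Tf lev μ * 4 ≤ 3 * P.L + 4 * ((n + 1) * (P.Sd + 1) + (2 * n + 1) * P.T lev) := by
    unfold Tf Mord
    have h1 : (n + 1 - μ) * P.T lev ≤ n * P.T lev := Nat.mul_le_mul_right _ (by omega)
    have h2 : (n + 1) * P.R (lev + 1) ≤ (n + 1) * (P.T lev + P.Sd) := Nat.mul_le_mul_left _ (by omega)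
    nlinarith
  have : ((P.Tf lev μ * 4 : ℕ) : ℝ) ≤ ((3 * P.L + 4 * ((n + 1) * (P.Sd + 1) + (2 * n + 1) * P.T lev) : ℕ) : ℝ) := by
    exact_mod_cast hnat
  push_cast at this
  linarith

/-! ### Slab centres and widths against the nodes -/

set_option maxHeartbeats 400000 in
/-- **`γb lev·Xs lev ≤ (nL/2 + wl 0)·(X/2 + 1)`, `wl lev·Xs lev ≤ wl 0·(X/2 + 1)`, `γb lev ≤ nL/2 + wl 0`, `wl lev ≤ wl 0`, all `> 0`**
(`γb (s+1) = wl s/2 = wl 0/2^{s+1}`, `Xs s ≤ 2^s X/2 + 1`). [folklore] -/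
theorem γb_wl_Xs_le (lev : ℕ) : P.γb lev * P.Xs lev ≤ ((n : ℝ) * P.L / 2 + P.wl 0) * (P.X / 2 + 1) ∧
    P.wl lev * P.Xs lev ≤ P.wl 0 * (P.X / 2 + 1) ∧ P.γb lev ≤ (n : ℝ) * P.L / 2 + P.wl 0 ∧ P.wl lev ≤ P.wl 0 ∧
    0 < P.γb lev ∧ 0 < P.wl lev := by
  have hw0 := (P.wl_facts 0).2
  have hwl := (P.wl_facts lev).2
  have hγ := (P.γb_facts lev).2.2.2
  have hX : (0 : ℝ) ≤ P.X := Nat.cast_nonneg _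
  have hL : (0 : ℝ) ≤ P.L := Nat.cast_nonneg _
  have hn : (0 : ℝ) ≤ n := Nat.cast_nonneg n
  have hXs := P.Xs_le_dbl lev
  have hXs1 : (1 : ℝ) ≤ P.Xs lev := by exact_mod_cast (P.Xs_cap_facts lev).1
  -- `wl lev = wl 0 / 2^lev`
  have hwl_eq : P.wl lev = P.wl 0 / 2 ^ lev := by unfold wl; simp
  have h2l : (1 : ℝ) ≤ 2 ^ lev := one_le_pow₀ (by norm_num)
  have h2l0 : (0 : ℝ) < 2 ^ lev := by positivity
  -- `wl lev · Xs lev ≤ (wl 0/2^lev)(2^lev X/2 + 1) = wl 0 (X/2 + 1/2^lev) ≤ wl 0 (X/2 + 1)`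
  have hB : P.wl lev * P.Xs lev ≤ P.wl 0 * (P.X / 2 + 1) := by
    rw [hwl_eq]
    calc P.wl 0 / 2 ^ lev * P.Xs lev ≤ P.wl 0 / 2 ^ lev * (2 ^ lev * P.X / 2 + 1) :=
          mul_le_mul_of_nonneg_left hXs (by positivity)
      _ = P.wl 0 * (P.X / 2 + 1 / 2 ^ lev) := by field_simp
      _ ≤ P.wl 0 * (P.X / 2 + 1) := by
          apply mul_le_mul_of_nonneg_left _ hw0.le
          have : 1 / (2 : ℝ) ^ lev ≤ 1 := by rw [div_le_one h2l0]; exact h2l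
          linarith
  have hD : P.wl lev ≤ P.wl 0 := by
    rw [hwl_eq]; exact div_le_self hw0.le h2l
  refine ⟨?_, hB, ?_, hD, hγ, hwl⟩
  · cases lev with
    | zero =>
      rw [(P.γb_facts 0).1]
      have := P.Xs_le_dbl 0
      simp at this
      exact mul_le_mul_of_nonneg_left this (by positivity)
    | succ s =>
      rw [(P.γb_facts s).2.1]
      -- `wl s/2 · Xs (s+1) ≤ (wl 0/2^{s+1})(2^{s+1}X/2 + 1) ≤ wl 0 (X/2+1) ≤ (nL/2 + wl 0)(X/2+1)`
      have hws : P.wl s / 2 = P.wl 0 / 2 ^ (s + 1) := by unfold wl; simp; rw [pow_succ]; ring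
      rw [hws]
      have hXs' := P.Xs_le_dbl (s + 1)
      have h2s : (0 : ℝ) < 2 ^ (s + 1) := by positivity
      have h2s1 : (1 : ℝ) ≤ 2 ^ (s + 1) := one_le_pow₀ (by norm_num)
      calc P.wl 0 / 2 ^ (s + 1) * P.Xs (s + 1) ≤ P.wl 0 / 2 ^ (s + 1) * (2 ^ (s + 1) * P.X / 2 + 1) :=
            mul_le_mul_of_nonneg_left hXs' (by positivity)
        _ = P.wl 0 * (P.X / 2 + 1 / 2 ^ (s + 1)) := by field_simp
        _ ≤ P.wl 0 * (P.X / 2 + 1) := by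
            apply mul_le_mul_of_nonneg_left _ hw0.le
            have : 1 / (2 : ℝ) ^ (s + 1) ≤ 1 := by rw [div_le_one h2s]; exact h2s1
            linarith
        _ ≤ ((n : ℝ) * P.L / 2 + P.wl 0) * (P.X / 2 + 1) := by
            apply mul_le_mul_of_nonneg_right _ (by positivity); nlinarith
  · cases lev with
    | zero => rw [(P.γb_facts 0).1]
    | succ s =>
      rw [(P.γb_facts s).2.1]
      have : P.wl s ≤ P.wl 0 := by
        have e : P.wl s = P.wl 0 / 2 ^ s := by unfold wl; simp
        rw [e]; exact div_le_self hw0.le (one_le_pow₀ (by norm_num))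
      have hws0 := (P.wl_facts s).2
      nlinarith

/-! ### The gain -/

set_option maxHeartbeats 400000 in
/-- **the odd-step gain**: `4·Z + 4·Z·(T−1)/(T+1) ≤ 2·Nh lev·T lev·G` (`Xs·(T+1) ≥ 4XL`, so `2·Xs·T·G ≥ 8·Z·T/(T+1)`).
[cite: Nesterenko2003, (4.25)] -/
theorem gain_O_ge (lev : ℕ) : 4 * P.Z + 4 * P.Z * ((P.T lev - 1 : ℝ) / (P.T lev + 1)) ≤ (((2 * P.Nh lev) * P.T lev : ℕ) : ℝ) * G n := by
  have hX := P.Xs_mul_ge lev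
  have hG := G_pos n
  have hT1 : (1 : ℝ) ≤ P.T lev := by exact_mod_cast (P.T_facts lev).1
  have hT0 : (0 : ℝ) < P.T lev + 1 := by linarith
  unfold Nh; push_cast
  have h1 : 4 * P.Z + 4 * P.Z * ((P.T lev - 1 : ℝ) / (P.T lev + 1)) = 8 * P.Z * (P.T lev / (P.T lev + 1)) := by
    field_simp; ring
  rw [h1]
  have h2 : P.Z * (P.T lev / (P.T lev + 1)) ≤ G n * (P.Xs lev * P.T lev) / 4 := by
    unfold Z
    rw [mul_div_assoc', div_le_div_iff₀ hT0 (by norm_num)]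
    have := mul_le_mul_of_nonneg_left hX (show (0:ℝ) ≤ G n * P.T lev by positivity)
    nlinarith
  nlinarith

/-- **the k-step gain**: `4·2^ν·Z + 4·2^ν·Z·(T−1)/(T+1) ≤ (2·Nf lev ν + 1)·T lev·G` (`Nf = 2^ν·Xs`). [cite: Nesterenko2003, (4.25)] -/
theorem gain_K_ge (lev ν : ℕ) : 4 * 2 ^ ν * P.Z + 4 * 2 ^ ν * P.Z * ((P.T lev - 1 : ℝ) / (P.T lev + 1)) ≤
    (((2 * P.Nf lev ν + 1) * P.T lev : ℕ) : ℝ) * G n := by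
  have h := P.gain_O_ge lev
  have hG := G_pos n
  have hT : (0 : ℝ) ≤ P.T lev := Nat.cast_nonneg _
  have h2 : (0 : ℝ) ≤ 2 ^ ν := by positivity
  unfold Nh at h; unfold Nf
  push_cast at h ⊢
  have e : 4 * 2 ^ ν * P.Z + 4 * 2 ^ ν * P.Z * ((P.T lev - 1 : ℝ) / (P.T lev + 1)) =
      2 ^ ν * (4 * P.Z + 4 * P.Z * ((P.T lev - 1 : ℝ) / (P.T lev + 1))) := by ring
  rw [e]
  have h3 := mul_le_mul_of_nonneg_left h h2
  nlinarith

set_option maxHeartbeats 400000 in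
/-- **absorbing the `T lev`-part of the orders into the gain surplus**: for `Λ ≤ (16/9)·X`,
`(2n+1)·T lev·Λ ≤ 4·Z·(T−1)/(T+1) + (2n+1)·Λ` (trivial at `T = 1`; for `T ≥ 2`, `(2n+1)Λ(T+1) ≤ (2n+1)(16/9)X·9L ≤ 4Z`). [folklore] -/
theorem T_absorb (lev : ℕ) {Λ : ℝ} (hΛ : Λ ≤ 16 / 9 * P.X) :
    (2 * (n : ℝ) + 1) * P.T lev * Λ ≤ 4 * P.Z * ((P.T lev - 1 : ℝ) / (P.T lev + 1)) + (2 * n + 1) * Λ := by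
  obtain ⟨hT1, hT8, -⟩ := P.T_facts lev
  have hT1r : (1 : ℝ) ≤ P.T lev := by exact_mod_cast hT1
  have hT8r : (P.T lev : ℝ) ≤ 8 * P.L := by exact_mod_cast hT8
  have hL1 := P.L_real.1
  have hX : (0 : ℝ) ≤ P.X := Nat.cast_nonneg _
  have hn : (0 : ℝ) ≤ n := Nat.cast_nonneg n
  have hT0 : (0 : ℝ) < P.T lev + 1 := by linarith
  -- `(2n+1) Λ (T+1) ≤ 4 Z`
  have hkey : (2 * (n : ℝ) + 1) * Λ * (P.T lev + 1) ≤ 4 * P.Z := by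
    unfold Z; rw [G_eq]
    have h1 : (P.T lev : ℝ) + 1 ≤ 9 * P.L := by linarith
    have h2 : (2 * (n : ℝ) + 1) * Λ ≤ (2 * n + 2) * (16 / 9 * P.X) := by nlinarith
    calc (2 * (n : ℝ) + 1) * Λ * (P.T lev + 1) ≤ (2 * n + 2) * (16 / 9 * P.X) * (9 * P.L) :=
          mul_le_mul h2 h1 hT0.le (by positivity)
      _ = 4 * (8 * (n + 1) * (P.X * P.L)) := by ring
  -- `(2n+1) T Λ = (2n+1) Λ + (2n+1) Λ (T - 1)` and `(2n+1) Λ (T-1) ≤ 4 Z (T-1)/(T+1)`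
  have h3 : (2 * (n : ℝ) + 1) * Λ * (P.T lev - 1) ≤ 4 * P.Z * ((P.T lev - 1 : ℝ) / (P.T lev + 1)) := by
    rw [mul_div_assoc', le_div_iff₀ hT0]
    have hTm : (0 : ℝ) ≤ P.T lev - 1 := by linarith
    nlinarith [mul_le_mul_of_nonneg_right hkey hTm]
  nlinarith

/-! ### Smallness from the `U₀`-domination -/

set_option maxHeartbeats 400000 in
/-- the logarithmic size of the θ-box times a node radius: for `0 < ρ ≤ 2^{Ŝ+n+6}·e^G·X` and `LbRK (2^(n−1)) lev jl > 0`,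
`log LbRK + log ρ ≤ 8·Z`. [folklore] -/
theorem log_LbRK_rho_le (lev : ℕ) {ρ : ℝ} (hρpos : 0 < ρ) (hρ : ρ ≤ 2 ^ (P.Sd + n + 6) * Real.exp (G n) * P.X)
    (hLpos : 0 < (P.LbRK (2 ^ (n - 1)) lev P.jl : ℝ)) :
    Real.log (P.LbRK (2 ^ (n - 1)) lev P.jl : ℝ) + Real.log ρ ≤ 8 * P.Z := by
  have hκ : 1 ≤ 2 ^ (n - 1) := Nat.one_le_two_pow
  obtain ⟨-, -, hLb, -⟩ := P.LbRK_le (2 ^ (n - 1)) hκ lev P.jl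
  obtain ⟨hZ0, hZW, hZn, hXL⟩ := P.Z_floors
  obtain ⟨hlogL, hlogX, hlogN, -, -⟩ := P.log_letters_le
  have hSd := P.Sd_log_le.2
  have hN := P.N_facts
  have hL := P.L_real
  have hX := P.X_floors.2.1
  have hG16 := (P.sixteen_le_G').1
  have hn1 : (1 : ℝ) ≤ n := by exact_mod_cast P.hn
  have hn0 : (0 : ℝ) < n := by linarith
  have hWN1 := P.WN_bounds.1
  have hl2 : Real.log 2 ≤ 1 := by have := Real.log_two_lt_d9; linarith
  have hl20 : 0 ≤ Real.log 2 := Real.log_nonneg one_le_two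
  -- `LbRK ≤ 4 (2^n n) N L`
  have hκr : ((2 ^ (n - 1) : ℕ) : ℝ) * n ≤ 2 ^ n * n := by
    push_cast
    have : (2 : ℝ) ^ (n - 1) ≤ 2 ^ n := pow_le_pow_right₀ (by norm_num) (Nat.sub_le _ _)
    exact mul_le_mul_of_nonneg_right this hn0.le
  have hNL : (0 : ℝ) ≤ P.N * P.L := by positivity
  have h1 : (P.LbRK (2 ^ (n - 1)) lev P.jl : ℝ) ≤ 4 * (2 ^ n * n) * (P.N * P.L) := by
    have := mul_le_mul_of_nonneg_right hκr hNL
    linarith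
  have h2n : (0 : ℝ) < 2 ^ n * n := mul_pos (by positivity) hn0
  have hNLpos : (0 : ℝ) < P.N * P.L := by have := hN.1; have := hL.2.1; positivity
  have hlogLb : Real.log (P.LbRK (2 ^ (n - 1)) lev P.jl : ℝ) ≤ 2 + 2 * n + P.WN + P.L / 2 ^ 21 := by
    have hpos : (0 : ℝ) < 4 * (2 ^ n * n) * (P.N * P.L) := by positivity
    have h4 : Real.log (4 : ℝ) ≤ 2 := by
      rw [show (4 : ℝ) = 2 ^ 2 by norm_num, Real.log_pow]; push_cast; linarith
    have hlogn : Real.log (n : ℝ) ≤ n := (Real.log_le_sub_one_of_pos hn0).trans (by linarith)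
    calc Real.log (P.LbRK (2 ^ (n - 1)) lev P.jl : ℝ) ≤ Real.log (4 * (2 ^ n * n) * (P.N * P.L)) := Real.log_le_log hLpos h1
      _ = Real.log 4 + (n * Real.log 2 + Real.log n) + (Real.log P.N + Real.log P.L) := by
          have hNL0 : P.N * (P.L : ℝ) ≠ 0 := hNLpos.ne'
          have h42 : (4 : ℝ) * (2 ^ n * n) ≠ 0 := by positivity
          rw [Real.log_mul h42 hNL0, Real.log_mul (by norm_num) h2n.ne',
            Real.log_mul (by positivity) hn0.ne', Real.log_mul hN.1.ne' hL.2.1.ne', Real.log_pow]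
      _ ≤ 2 + 2 * n + P.WN + P.L / 2 ^ 21 := by
          have : (n : ℝ) * Real.log 2 ≤ n := by nlinarith
          linarith
  have hlogρ : Real.log ρ ≤ (P.Sd + n + 6) * Real.log 2 + G n + P.X := by
    have hpos : (0 : ℝ) < 2 ^ (P.Sd + n + 6) * Real.exp (G n) * P.X := by positivity
    calc Real.log ρ ≤ Real.log (2 ^ (P.Sd + n + 6) * Real.exp (G n) * P.X) := Real.log_le_log hρpos hρ
      _ = (P.Sd + n + 6) * Real.log 2 + G n + Real.log P.X := by
          rw [Real.log_mul (by positivity) (by positivity), Real.log_mul (by positivity) (Real.exp_pos _).ne',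
            Real.log_pow, Real.log_exp]; push_cast; ring
      _ ≤ (P.Sd + n + 6) * Real.log 2 + G n + P.X := by linarith
  have hSd' : ((P.Sd : ℝ) + n + 6) * Real.log 2 ≤ 10 * n + 29 + P.WN + n + 6 := by
    have e : ((P.Sd : ℝ) + n + 6) * Real.log 2 = P.Sd * Real.log 2 + (n + 6) * Real.log 2 := by ring
    have : ((n : ℝ) + 6) * Real.log 2 ≤ n + 6 := by nlinarith
    linarith
  -- the summands against `Z`: `X ≤ Z/2^30·…`; we use the crude `X ≤ Z`, `WN ≤ Z/64`, `L ≤ Z/512`, `n + 1 ≤ Z/2^30`, `G ≤ Z`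
  rw [G_eq] at hlogρ
  have hX1 : (P.X : ℝ) ≤ P.Z := by
    have : (P.X : ℝ) * 1 ≤ P.X * P.L := mul_le_mul_of_nonneg_left hL.1 (Nat.cast_nonneg _)
    rw [hXL, G_eq] at this
    have h8 : P.Z / (8 * ((n : ℝ) + 1)) ≤ P.Z := div_le_self hZ0.le (by linarith)
    linarith only [this, h8]
  have hWNZ : P.WN ≤ P.Z / 64 := by
    rw [le_div_iff₀ (by norm_num)]
    have h1 : (1 : ℝ) ≤ ((n : ℝ) + 1) * P.L := by nlinarith only [hn1, hL.1]
    have h2 := mul_le_mul_of_nonneg_left h1 (show (0 : ℝ) ≤ 64 * P.WN by positivity)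
    have e : 64 * P.WN * (((n : ℝ) + 1) * P.L) = 64 * ((n : ℝ) + 1) * P.L * P.WN := by ring
    linarith only [h2, e, hZW]
  have hLZ : (P.L : ℝ) ≤ P.Z / 512 := by
    rw [le_div_iff₀ (by norm_num)]
    have h1 : (1 : ℝ) ≤ ((n : ℝ) + 1) ^ 2 := by nlinarith only [hn1]
    have h2 := mul_le_mul_of_nonneg_left h1 (show (0 : ℝ) ≤ 512 * P.L by positivity)
    have e : 512 * (P.L : ℝ) * ((n : ℝ) + 1) ^ 2 = 512 * ((n : ℝ) + 1) ^ 2 * P.L := by ring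
    linarith only [h2, e, hZn]
  have hnZ : (n : ℝ) + 1 ≤ P.Z / 2 ^ 30 := by
    rw [le_div_iff₀ (by positivity)]
    have h26 : (2 : ℝ) ^ 26 ≤ P.L := le_trans (pow_le_pow_right₀ (by norm_num) (by have := P.hn; omega)) hL.2.2.1
    have h3 : ((n : ℝ) + 1) * 2 ^ 30 ≤ 512 * ((n : ℝ) + 1) ^ 2 * 2 ^ 26 := by
      rw [show (2 : ℝ) ^ 30 = 2 ^ 4 * 2 ^ 26 by norm_num]; nlinarith only [hn1]
    have h2 : 512 * ((n : ℝ) + 1) ^ 2 * 2 ^ 26 ≤ 512 * ((n : ℝ) + 1) ^ 2 * P.L :=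
      mul_le_mul_of_nonneg_left h26 (by positivity)
    linarith only [h3, h2, hZn]
  have hZ30 : P.Z / 2 ^ 30 ≤ P.Z / 64 := div_le_div_of_nonneg_left hZ0.le (by norm_num) (by norm_num)
  linarith only [hlogLb, hlogρ, hSd', hSd, hlogN, hX1, hWNZ, hLZ, hnZ, hZ30, hZ0, hn1, hWN1]

set_option maxHeartbeats 400000 in
/-- **`LbRK (2^(n−1)) lev jl·δR c·ρ ≤ 1`** for `0 ≤ ρ ≤ 2^{Ŝ+n+6}·e^G·X` and `2^63 ≤ c`: `log(LbRK·ρ) ≤ 8·Z ≤ 2^{3n}·Z ≤ U0 c`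
(p4's `U0_ge`). [folklore] -/
theorem small_of_U0 (lev : ℕ) {ρ : ℝ} (hρ0 : 0 ≤ ρ) (hρ : ρ ≤ 2 ^ (P.Sd + n + 6) * Real.exp (G n) * P.X) {c : ℝ}
    (hc : (2 : ℝ) ^ (3 + 60) ≤ c) : (P.LbRK (2 ^ (n - 1)) lev P.jl : ℝ) * P.δR c * ρ ≤ 1 := by
  have hU := P.U0_ge 3 hc
  have hZ0 := P.Z_floors.1
  have hLb0 : (0 : ℝ) ≤ P.LbRK (2 ^ (n - 1)) lev P.jl := Nat.cast_nonneg _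
  by_cases hρz : ρ = 0
  · rw [hρz]; simp
  have hρpos : 0 < ρ := lt_of_le_of_ne hρ0 (Ne.symm hρz)
  by_cases hLz : (P.LbRK (2 ^ (n - 1)) lev P.jl : ℝ) = 0
  · rw [hLz]; simp
  have hLpos : 0 < (P.LbRK (2 ^ (n - 1)) lev P.jl : ℝ) := lt_of_le_of_ne hLb0 (Ne.symm hLz)
  have hlog := P.log_LbRK_rho_le lev hρpos hρ hLpos
  have h8 : 8 * P.Z ≤ (2 : ℝ) ^ (3 * n) * P.Z := by
    have : (8 : ℝ) ≤ 2 ^ (3 * n) := by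
      calc (8 : ℝ) = 2 ^ 3 := by norm_num
        _ ≤ 2 ^ (3 * n) := pow_le_pow_right₀ (by norm_num) (by have := P.hn; omega)
    nlinarith
  have e : (P.LbRK (2 ^ (n - 1)) lev P.jl : ℝ) * P.δR c * ρ =
      Real.exp (Real.log (P.LbRK (2 ^ (n - 1)) lev P.jl : ℝ) + Real.log ρ) * Real.exp (-P.U0 c) := by
    rw [Real.exp_add, Real.exp_log hLpos, Real.exp_log hρpos]; unfold δR; ring
  rw [e, ← Real.exp_add]
  apply Real.exp_le_one_iff.mpr
  linarith

end ArchG3Rec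

end Summit.ABC.StewartYu
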